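/-
HONEST FRAMING: certified error envelopes and provably optimal rounding/accumulation schemes for
low-precision formats under stated cost models; every table by two implementations; no hardware
or vendor claims.
-/
import Mathlib.Data.Rat.Floor
import Summits.Ventures.CertifiedArithmetic.LowPrec.OptDemotionRoutingMidconvex

/-!
# The demotion law (Theorem T8), part 8i: MONOTONICITY (M) of the bit-routing value (opt gen 13 §4)

opt gen 13 (README §4, (M)): `v ≤ v′` floats ⟹ `BR_t(v) ≤ BR_t(v′)`.  In exponents: for routable
nonempty configurations `S, S'` with `Σ_{e∈S} 2^e ≤ Σ_{e∈S'} 2^e`, `BR_t(S) ≤ BR_t(S')`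
(`treeBR_mono`).  One grid step `v ↦ v + ulp(v)` (`treeBR_le_succ`) is either
* the ulp position `ℓ = max S + 1 - q` is free: ADD A SHADOWED LOW BIT — route `ℓ` alongside the
  leading bit, which it never overtakes, so no top and no injection changes (`treeBRw_le_insert_low`;
  this replaces README's "along ANY path", which is not literally possible when `ℓ` would become
  the top of a configuration of injected bits); or
* `ℓ ∈ S`: the CARRY through the run `ℓ, …, ℓ+j`, which never loses (`treeBR_le_carry`, part 8h).
The steps are chained along the float grid (part 8i′: `val`, `eq_of_val_eq`, `val_succ_le_of_lt`).
-/

namespace Summit.Ventures.CertifiedArithmetic.LowPrec.Opt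

open Literature.ComputerArithmetic.JeannerodRump2018
open Literature.ComputerArithmetic.JeannerodRump2018.SumTree

/-! ## Adding a shadowed low bit -/

/-- Inserting a fresh element commutes with the set difference. -/
theorem insert_sdiff_insert_of_notMem {ℓ : ℤ} {T : Finset ℤ} (A : Finset ℤ) (hT : ℓ ∉ T) :
    insert ℓ T \ insert ℓ A = T \ A := by
  ext x
  simp only [Finset.mem_sdiff, Finset.mem_insert, not_or]
  constructor
  · rintro ⟨h | h, hne, hxA⟩
    · exact absurd h hne
    · exact ⟨h, hxA⟩
  · rintro ⟨hxT, hxA⟩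
    exact ⟨Or.inr hxT, fun h => hT (h ▸ hxT), hxA⟩

/-- ADDING A SHADOWED LOW BIT NEVER LOSES: a fresh bit `ℓ` below the top of `C` with `C ∪ {ℓ}`
routable can be routed alongside the leading bit (any weight). -/
theorem treeBRw_le_insert_low {q : ℕ} (W : ℤ → ℚ) :
    ∀ (t : SumTree) (C : Finset ℤ) (hne : C.Nonempty) (ℓ : ℤ), ℓ ∉ C → ℓ < C.max' hne →
      Routable q (insert ℓ C) → treeBRw q W t C ≤ treeBRw q W t (insert ℓ C)
  | .leaf _, C, _, ℓ, _, _, _ => by simp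
  | .node a b, C, hne, ℓ, hℓ, hlt, hr => by
      set c₀ := C.max' hne with hc₀
      have hc₀C : c₀ ∈ C := Finset.max'_mem C hne
      have hne' : (insert ℓ C).Nonempty := Finset.insert_nonempty _ _
      have htop : (insert ℓ C).max' hne' = c₀ := by
        refine le_antisymm (Finset.max'_le _ hne' _ fun y hy => ?_)
          (Finset.le_max' _ _ (Finset.mem_insert_of_mem hc₀C))
        rcases Finset.mem_insert.1 hy with hy | hy
        · rw [hy]; exact hlt.le
        · exact Finset.le_max' C y hy
      have hιℓ : c₀ - (q : ℤ) < ℓ := by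
        have := hr c₀ (Finset.mem_insert_of_mem hc₀C) ℓ (Finset.mem_insert_self _ _); linarith
      have hℓT : ℓ ∉ insert (c₀ - (q : ℤ)) C := by
        intro h
        rcases Finset.mem_insert.1 h with h | h
        · linarith
        · exact hℓ h
      -- routability of a part with ℓ added
      have hrout : ∀ A : Finset ℤ, A ⊆ insert (c₀ - (q : ℤ)) C → Routable q A → Routable q (insert ℓ A) := by
        intro A hA hrA x hx y hy
        have key : ∀ z ∈ A, z ≤ ℓ + ((q : ℤ) - 1) ∧ ℓ ≤ z + ((q : ℤ) - 1) := by
          intro z hz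
          rcases Finset.mem_insert.1 (hA hz) with hzι | hzC
          · rw [hzι]; constructor <;> linarith
          · exact ⟨hr z (Finset.mem_insert_of_mem hzC) ℓ (Finset.mem_insert_self _ _),
              hr ℓ (Finset.mem_insert_self _ _) z (Finset.mem_insert_of_mem hzC)⟩
        rcases Finset.mem_insert.1 hx with hx | hx <;> rcases Finset.mem_insert.1 hy with hy | hy
        · rw [hx, hy]; linarith
        · rw [hx]; exact (key y hy).2
        · rw [hy]; exact (key x hx).1
        · exact hrA x hx y hy
      have hfold := fold_max_nonneg (splits q (insert ℓ C) ((insert ℓ C).max' hne'))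
        (fun AB => treeBRw q W a AB.1 + treeBRw q W b AB.2)
      rcases treeBRw_node_eq (q := q) (W := W) (a := a) (b := b) hne with h0 | ⟨AB, hAB, hval⟩
      · rw [h0, treeBRw_node q W a b hne', htop, ← hc₀]
        rw [htop] at hfold
        linarith
      · rw [hval]
        obtain ⟨hA, hB, hdisj, hcov, hrA, hrB⟩ := of_mem_splits (A := AB.1) (B := AB.2) hAB
        obtain ⟨h1, -, -⟩ := mem_splits.1 hAB
        have hc₀AB := hcov hc₀C
        rw [Finset.mem_union] at hc₀AB
        -- the maximum of a part containing c₀ is c₀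
        have hmaxpart : ∀ A : Finset ℤ, A ⊆ insert (c₀ - (q : ℤ)) C → c₀ ∈ A → ∀ hA : A.Nonempty,
            A.max' hA = c₀ := by
          intro A hA hc hAne
          refine le_antisymm (Finset.max'_le _ hAne _ fun y hy => ?_) (Finset.le_max' _ _ hc)
          rcases Finset.mem_insert.1 (hA hy) with hyι | hyC
          · have : (0 : ℤ) ≤ q := by positivity
            rw [hyι]; linarith
          · exact Finset.le_max' C y hyC
        rcases hc₀AB with hcA | hcB
        · -- ℓ joins the part A of the leading bit
          have hAne : AB.1.Nonempty := ⟨c₀, hcA⟩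
          have hℓA : ℓ ∉ AB.1 := fun h => hℓT (hA h)
          have hltA : ℓ < AB.1.max' hAne := by rw [hmaxpart AB.1 hA hcA hAne]; exact hlt
          have ih := treeBRw_le_insert_low W a AB.1 hAne ℓ hℓA hltA (hrout AB.1 hA hrA)
          have hmem : (insert ℓ AB.1, AB.2) ∈ splits q (insert ℓ C) ((insert ℓ C).max' hne') := by
            rw [htop]
            refine mem_splits.2 ⟨?_, hrout AB.1 hA hrA, hrB⟩
            rcases h1 with ⟨hs, hB'⟩ | ⟨hs, hB'⟩
            · left
              exact ⟨Finset.insert_subset_insert ℓ hs, by rw [hB', insert_sdiff_insert_of_notMem _ hℓ]⟩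
            · right
              refine ⟨(Finset.insert_subset_insert ℓ hs).trans (Finset.insert_comm ℓ _ C).subset, ?_⟩
              rw [hB', Finset.insert_comm, insert_sdiff_insert_of_notMem _ hℓT]
          have := split_le_treeBRw_node (q := q) (W := W) (a := a) (b := b) hne' hmem
          rw [htop] at this
          linarith
        · -- ℓ joins the part B of the leading bit
          have hBne : AB.2.Nonempty := ⟨c₀, hcB⟩
          have hℓB : ℓ ∉ AB.2 := fun h => hℓT (hB h)
          have hltB : ℓ < AB.2.max' hBne := by rw [hmaxpart AB.2 hB hcB hBne]; exact hlt
          have ih := treeBRw_le_insert_low W b AB.2 hBne ℓ hℓB hltB (hrout AB.2 hB hrB)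
          have hℓA : ℓ ∉ AB.1 := fun h => hℓT (hA h)
          have hmem : (AB.1, insert ℓ AB.2) ∈ splits q (insert ℓ C) ((insert ℓ C).max' hne') := by
            rw [htop]
            refine mem_splits.2 ⟨?_, hrA, hrout AB.2 hB hrB⟩
            rcases h1 with ⟨hs, hB'⟩ | ⟨hs, hB'⟩
            · left
              refine ⟨hs.trans (Finset.subset_insert _ _), ?_⟩
              rw [hB', Finset.insert_sdiff_of_notMem _ hℓA]
            · right
              refine ⟨hs.trans ((Finset.subset_insert ℓ _).trans (Finset.insert_comm ℓ _ C).subset), ?_⟩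
              rw [hB', Finset.insert_comm, Finset.insert_sdiff_of_notMem _ hℓA]
          have := split_le_treeBRw_node (q := q) (W := W) (a := a) (b := b) hne' hmem
          rw [htop] at this
          linarith

/-! ## One grid step, and monotonicity -/

section Mono

variable {q : ℕ}

/-- ONE GRID STEP `v ↦ v + ulp(v)` NEVER LOSES: for a routable nonempty `S` (top `e₀`,
`ulp = 2^(e₀+1-q)`) the next configuration `S⁺` — `S ∪ {e₀+1-q}` if that position is free, else
the carry through the run starting there — is routable, worth `val S + ulp`, and
`BR_t(S) ≤ BR_t(S⁺)`. -/
theorem exists_succ (hq : 1 ≤ q) (t : SumTree) {S : Finset ℤ} (hne : S.Nonempty) (hS : Routable q S) :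
    ∃ S' : Finset ℤ, S'.Nonempty ∧ Routable q S' ∧
      val S' = val S + (2 : ℚ) ^ (S.max' hne + 1 - q) ∧ treeBR q t S ≤ treeBR q t S' := by
  classical
  set e₀ := S.max' hne with he₀
  have he₀S : e₀ ∈ S := Finset.max'_mem S hne
  set ℓ : ℤ := e₀ + 1 - q with hℓ
  have hq1 : (1 : ℤ) ≤ q := by exact_mod_cast hq
  have hlow : ∀ e ∈ S, ℓ ≤ e ∧ e ≤ e₀ := fun e he => by
    have := hS e₀ he₀S e he
    exact ⟨by rw [hℓ]; linarith, Finset.le_max' S e he⟩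
  by_cases hℓS : ℓ ∈ S
  · ---- the carry through the run ℓ, ℓ+1, …, ℓ+j
    have hex : ∃ j : ℕ, ℓ + ((j : ℤ) + 1) ∉ S := by
      refine ⟨(e₀ - ℓ).toNat, fun h => ?_⟩
      have := (hlow _ h).2
      rw [Int.toNat_of_nonneg (by rw [hℓ]; linarith)] at this
      linarith
    let j := Nat.find hex
    have hj : ℓ + ((j : ℤ) + 1) ∉ S := Nat.find_spec hex
    have hrun : ∀ i : ℕ, i ≤ j → ℓ + (i : ℤ) ∈ S := by
      intro i hi
      rcases Nat.eq_zero_or_pos i with rfl | hpos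
      · simpa using hℓS
      · have hlt : i - 1 < j := by omega
        have := Nat.find_min hex hlt
        rw [not_not] at this
        have e1 : (((i - 1 : ℕ) : ℤ) + 1) = (i : ℤ) := by
          rw [Nat.cast_sub (by omega)]; push_cast; ring
        rwa [e1] at this
    set β' : ℤ := ℓ + ((j : ℤ) + 1) with hβ'
    set run : Finset ℤ := (Finset.range (j + 1)).image fun i : ℕ => ℓ + (i : ℤ) with hrundef
    have hrunS : run ⊆ S := by
      intro r hr
      obtain ⟨i, hi, rfl⟩ := Finset.mem_image.1 hr
      exact hrun i (by rw [Finset.mem_range] at hi; omega)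
    -- what survives the carry lies above β'
    have hrest : ∀ e ∈ S \ run, β' < e ∧ e ≤ e₀ := by
      intro e he
      obtain ⟨heS, her⟩ := Finset.mem_sdiff.1 he
      refine ⟨?_, (hlow e heS).2⟩
      by_contra hle
      have hle := not_lt.1 hle
      rcases eq_or_lt_of_le hle with h | h
      · exact hj (h ▸ heS)
      · -- ℓ ≤ e < β' : e is in the run
        apply her
        rw [hrundef, Finset.mem_image]
        refine ⟨(e - ℓ).toNat, ?_, ?_⟩
        · rw [Finset.mem_range]
          have := (hlow e heS).1
          have : (e - ℓ).toNat < j + 1 := by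
            have h3 : e - ℓ < (j : ℤ) + 1 := by rw [hβ'] at h; linarith
            omega
          exact this
        · rw [Int.toNat_of_nonneg (by linarith [(hlow e heS).1])]; ring
    have hS' : Routable q (insert β' (S \ run)) := by
      intro x hx y hy
      have hb : ∀ z ∈ insert β' (S \ run), β' ≤ z ∧ z ≤ β' + ((q : ℤ) - 1) := by
        intro z hz
        rcases Finset.mem_insert.1 hz with hz | hz
        · rw [hz]; constructor <;> linarith
        · have := hrest z hz
          constructor
          · linarith [this.1]
          · rw [hβ']; have := this.2; rw [hℓ]; linarith
      have h1 := hb x hx; have h2 := hb y hy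
      linarith [h1.2, h2.1]
    refine ⟨insert β' (S \ run), Finset.insert_nonempty _ _, hS', ?_, treeBR_le_carry t hS hrun hj hS'⟩
    -- the value
    have hβ'S : β' ∉ S \ run := fun h => hj (Finset.mem_sdiff.1 h).1
    rw [val_insert hβ'S, val_eq_sdiff_add hrunS, hrundef, val_run, hβ']
    ring
  · ---- the ulp position is free: add a shadowed low bit
    have hlt : ℓ < e₀ := lt_of_le_of_ne (by rw [hℓ]; linarith) fun h => hℓS (h ▸ he₀S)
    have hS' : Routable q (insert ℓ S) := by
      intro x hx y hy
      have hb : ∀ z ∈ insert ℓ S, ℓ ≤ z ∧ z ≤ ℓ + ((q : ℤ) - 1) := by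
        intro z hz
        rcases Finset.mem_insert.1 hz with hz | hz
        · rw [hz]; constructor <;> linarith
        · have := hlow z hz
          exact ⟨this.1, by rw [hℓ]; linarith [this.2]⟩
      have h1 := hb x hx; have h2 := hb y hy
      linarith [h1.2, h2.1]
    refine ⟨insert ℓ S, Finset.insert_nonempty _ _, hS', by rw [val_insert hℓS]; ring, ?_⟩
    exact treeBRw_le_insert_low _ t S hne ℓ hℓS hlt hS'

/-- Monotonicity along at most `N` grid steps. -/
theorem treeBR_mono_steps (hq : 1 ≤ q) (t : SumTree) :
    ∀ (N : ℕ) (S S' : Finset ℤ) (hne : S.Nonempty), S'.Nonempty → Routable q S → Routable q S' →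
      val S ≤ val S' → val S' ≤ val S + N * (2 : ℚ) ^ (S.max' hne + 1 - q) →
      treeBR q t S ≤ treeBR q t S'
  | 0, S, S', hne, hne', hS, hS', hle, hN => by
      simp only [Nat.cast_zero, zero_mul, add_zero] at hN
      rw [eq_of_val_eq S S' (le_antisymm hle hN)]
  | N + 1, S, S', hne, hne', hS, hS', hle, hN => by
      rcases eq_or_lt_of_le hle with heq | hlt
      · rw [eq_of_val_eq S S' heq]
      · obtain ⟨S₁, hne₁, hS₁, hval₁, hBR₁⟩ := exists_succ hq t hne hS
        have hgrid := val_succ_le_of_lt hne hne' hS hS' hlt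
        have hle₁ : val S₁ ≤ val S' := by rw [hval₁]; exact hgrid
        -- the grid of S₁ is at least as coarse
        have hmax : S.max' hne ≤ S₁.max' hne₁ :=
          max'_le_of_val_le hne hne₁ (by rw [hval₁]; linarith [zpow_pos (by norm_num : (0:ℚ) < 2) (S.max' hne + 1 - q)])
        have hulp : (2 : ℚ) ^ (S.max' hne + 1 - q) ≤ (2 : ℚ) ^ (S₁.max' hne₁ + 1 - q) :=
          zpow_le_zpow_right₀ (by norm_num) (by omega)
        have hN₁ : val S' ≤ val S₁ + N * (2 : ℚ) ^ (S₁.max' hne₁ + 1 - q) := by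
          rw [hval₁]; push_cast at hN
          nlinarith [mul_le_mul_of_nonneg_left hulp (Nat.cast_nonneg N : (0 : ℚ) ≤ N)]
        exact hBR₁.trans (treeBR_mono_steps hq t N S₁ S' hne₁ hne' hS₁ hS' hle₁ hN₁)

/-- **MONOTONICITY (M)** (opt gen 13 §4; every tree, every precision `q ≥ 1`): for routable
nonempty configurations (`q`-bit floats) `S, S'` with `Σ_S 2^e ≤ Σ_{S'} 2^e`,
`BR_t(S) ≤ BR_t(S')`. -/
theorem treeBR_mono (hq : 1 ≤ q) (t : SumTree) {S S' : Finset ℤ} (hne : S.Nonempty) (hne' : S'.Nonempty)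
    (hS : Routable q S) (hS' : Routable q S') (h : val S ≤ val S') : treeBR q t S ≤ treeBR q t S' := by
  have hpos : (0 : ℚ) < (2 : ℚ) ^ (S.max' hne + 1 - q) := zpow_pos (by norm_num) _
  set x := (val S' - val S) / (2 : ℚ) ^ (S.max' hne + 1 - q) with hx
  have hN : x ≤ (⌈x⌉₊ : ℕ) := Nat.le_ceil x
  refine treeBR_mono_steps hq t ⌈x⌉₊ S S' hne hne' hS hS' h ?_
  rw [hx, div_le_iff₀ hpos] at hN
  linarith

end Mono

end Summit.Ventures.CertifiedArithmetic.LowPrec.Opt
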